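import Literature.Probability.LatticeModels.IsingLaceThroughPivotal
import HarnessLib

/-!
# Locality and one-bond blindness of Sakai's event `E_N(v, x; 𝒜)`; parities at the cut `𝒞^b(v)`

Topic `Probability/LatticeModels`, grouping namespace `IsingLace`. Second file of the proof of the
second-expansion identity (2.35) of A. Sakai, *Lace expansion for the Ising model* (the tree's named
fact `IsingLace.Sakai2007_secondExpansion`). The steps (2.31)–(2.34) of §2.2.2 manipulate the
summand `1{E_{m+n}(v,b̲;𝒜) off b} 1{m_b even, n_b odd} 1{b̄ ⟷ x in 𝒞^b_{m+n}(v)ᶜ}` of (2.29): the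
parities of `m_b`, `n_b` are read off from the source constraints ("that is the only possible
combination consistent with the source constraints and the conditions in the indicators"), the
parity of `n_b` is flipped, one conditions on the cluster `𝒞^b_{m+n}(v) = ℬ` and decouples the
bonds off `ℬ`, and finally "off `b`" and the parity constraints are omitted "using the source
constraints and the fact that `⟨φ_b̄ φ_x⟩_{𝒞ᶜ} = 0` whenever `b̄ ∈ 𝒞^b_{m+n}(v)`". This file proves
the three facts about the event `E_N(v, y; 𝒜)` (`IsingLace.laceEvent`) and about parities that
these manipulations use silently:

* `laceEvent_congr_of_agree` — **locality**: with `C_M(v) = S`, the event `E_M(v, y; 𝒜)` for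
  `y ∈ S` only depends on the current on the bonds meeting `S` (every constituent connection is
  decided by walks from `v` or from `y`, which stay in `S`); this is what lets the bonds off the
  frozen cluster be resummed in (2.32)–(2.33);
* `laceEvent_update_iff` — **one-bond blindness**: if `b̄ ∉ 𝒞^b_N(v)` and `y ∈ 𝒞^b_N(v)` then
  `E_{N∖b}(v, y; 𝒜) = E_N(v, y; 𝒜)` (no path between two vertices of the cluster crosses the cut),
  the content of "we can omit 'off `b`'" in (2.34) and of the equivalence between the literal
  reading of `{E off b}` and its evaluation at `n_b = 0` in (2.29);
* the **parities at the cut** (handshake on `𝒞^b_N(v)` for a sub-current with `n_b` reset):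
  `even_of_sources_empty` (`∂m = ∅` ⟹ `m_b` even), `odd_of_sources_eq_pair` (`∂n = v △ x`, `x ∉ 𝒞`
  ⟹ `n_b` odd), `even_of_sources_eq_pair` (`∂n = v △ b̲`, `b̄ ∉ 𝒞` ⟹ `n_b` even) — (2.31), (2.34).

Everything here is proved; no definitions, no named facts.

## References

* A. Sakai, *Lace expansion for the Ising model*, Comm. Math. Phys. 272 (2007) 283–344,
  arXiv:math-ph/0510093: §2.2.2, (2.28)–(2.34) [Sakai2007].
(Equation numbers are those of the arXiv version held in the literature store, every display
counted.)
-/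

noncomputable section

open Finset
open scoped symmDiff
open Literature.Combinatorics.SimpleGraph

namespace Literature.Probability.LatticeModels

variable {V : Type*} [Fintype V] [DecidableEq V] {G : SimpleGraph V} [DecidableRel G.Adj]

namespace IsingLace

/-! ## Transfer of the connectivity predicates between currents agreeing near a closed set -/

omit [DecidableEq V] in
/-- `x ⟷_N y in 𝒜ᶜ` is symmetric. [folklore] -/
theorem ConnAvoid.symm {N : Current G} {A : Finset V} {x y : V} (h : ConnAvoid G N A x y) :
    ConnAvoid G N A y x :=
  ⟨h.2.1, h.1, SimpleGraph.Reachable.symm h.2.2⟩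

omit [DecidableEq V] in
/-- A vertex set containing the cluster of `v` for a bigger current is closed under the trace
adjacency of a smaller one. [folklore] -/
theorem closed_of_le {N M : Current G} (hle : N ≤ M) {v : V} {S : Finset V} (hS : M.cluster v = S) :
    ∀ a w, a ∈ S → (Percolation.openGraph N.traced).Adj a w → w ∈ S := by
  intro a w ha hadj
  have hadj' : (Percolation.openGraph M.traced).Adj a w :=
    Percolation.openGraph_mono (Current.traced_mono hle) hadj
  rw [← hS] at ha ⊢
  exact Current.mem_cluster_of_adj ha hadj'

/-- Agreement on the bonds meeting `S` survives resetting a bond. [folklore] -/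
theorem agree_update {N N' : Current G} {S : Finset V}
    (hagree : ∀ e : G.edgeFinset, ¬Current.EdgeOff S (e : Sym2 V) → N' e = N e) (f : G.edgeFinset) :
    ∀ e : G.edgeFinset, ¬Current.EdgeOff S (e : Sym2 V) →
      Function.update N' f 0 e = Function.update N f 0 e := by
  intro e he
  by_cases hef : e = f
  · subst hef
    rw [Function.update_self, Function.update_self]
  · rw [Function.update_of_ne hef, Function.update_of_ne hef, hagree e he]

omit [DecidableEq V] in
/-- **Transfer of `a ⟷ y`** from a vertex `a` of a set `S` closed under the trace of `N`, to a
current `N'` agreeing with `N` on the bonds meeting `S`. [folklore] -/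
theorem conn_of_agree {N N' : Current G} {S : Finset V}
    (hcl : ∀ a w, a ∈ S → (Percolation.openGraph N.traced).Adj a w → w ∈ S)
    (hagree : ∀ e : G.edgeFinset, ¬Current.EdgeOff S (e : Sym2 V) → N' e = N e)
    {a y : V} (ha : a ∈ S) (h : Conn G N a y) : Conn G N' a y :=
  Current.reachable_transfer (P := (· ∈ S))
    (fun u w hu hadj => ⟨(traceAdj_congr_of_agree hagree hu).1 hadj, hcl u w hu hadj⟩) ha h

omit [DecidableEq V] in
/-- **Transfer of `a ⟷ y in 𝒜ᶜ`** under the same hypotheses. [folklore] -/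
theorem connAvoid_of_agree {N N' : Current G} {S : Finset V}
    (hcl : ∀ a w, a ∈ S → (Percolation.openGraph N.traced).Adj a w → w ∈ S)
    (hagree : ∀ e : G.edgeFinset, ¬Current.EdgeOff S (e : Sym2 V) → N' e = N e)
    {A : Finset V} {a y : V} (ha : a ∈ S) (h : ConnAvoid G N A a y) : ConnAvoid G N' A a y := by
  refine ⟨h.1, h.2.1, ?_⟩
  have h3 := h.2.2
  rw [Current.mem_connIn_iff] at h3 ⊢
  refine Current.reachable_transfer (P := (· ∈ S)) (fun u w hu hadj => ?_) ha h3
  rw [openGraph_tracedIn_offGraph_adj] at hadj ⊢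
  exact ⟨⟨(traceAdj_congr_of_agree hagree hu).1 hadj.1, hadj.2⟩, hcl u w hu hadj.1⟩

/-! ## Locality of the event `E_N(v, y; 𝒜)` -/

/-- **Locality of `E_M(v, y; 𝒜)`**: if `C_M(v) = S`, `y ∈ S`, and `M'` agrees with `M` on every bond
meeting `S`, then `E_M(v, y; 𝒜) ⟺ E_{M'}(v, y; 𝒜)` — the through-connections from `v`, the pivotal
bonds for `v ⟷ y` from `v` and the clusters `𝒞^{b'}(v)` are all decided by walks from `v` or from
`y`, which never leave `S`. [cite: Sakai2007, (2.28) and (2.32)–(2.33)] -/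
theorem laceEvent_congr_of_agree {M M' : Current G} {v : V} {S : Finset V} (hS : M.cluster v = S)
    (hagree : ∀ e : G.edgeFinset, ¬Current.EdgeOff S (e : Sym2 V) → M' e = M e) {A : Finset V}
    {y : V} (hy : y ∈ S) : laceEvent G M A v y ↔ laceEvent G M' A v y := by
  have hS' : M'.cluster v = S := Current.cluster_eq_of_agree hS hagree
  have hagree' : ∀ e : G.edgeFinset, ¬Current.EdgeOff S (e : Sym2 V) → M e = M' e :=
    fun e he => (hagree e he).symm
  have hv : v ∈ S := hS ▸ Current.mem_cluster_self M v
  -- closedness of `S` for `M`, `M'` and the currents with one bond reset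
  have hclM := closed_of_le (le_refl M) hS
  have hclM' := closed_of_le (le_refl M') hS'
  have hclMe : ∀ f, ∀ a w, a ∈ S →
      (Percolation.openGraph (Current.traced (Function.update M f 0))).Adj a w → w ∈ S :=
    fun f => closed_of_le (update_zero_le M f) hS
  have hclM'e : ∀ f, ∀ a w, a ∈ S →
      (Percolation.openGraph (Current.traced (Function.update M' f 0))).Adj a w → w ∈ S :=
    fun f => closed_of_le (update_zero_le M' f) hS'
  -- the constituent equivalences
  have hconn : ∀ {a z : V}, a ∈ S → (Conn G M a z ↔ Conn G M' a z) := fun ha =>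
    ⟨conn_of_agree hclM hagree ha, conn_of_agree hclM' hagree' ha⟩
  have hav : ∀ {B : Finset V} {a z : V}, a ∈ S → (ConnAvoid G M B a z ↔ ConnAvoid G M' B a z) :=
    fun ha => ⟨connAvoid_of_agree hclM hagree ha, connAvoid_of_agree hclM' hagree' ha⟩
  have hthr : ∀ a : V, ConnThrough G M A v a ↔ ConnThrough G M' A v a := fun a =>
    and_congr (hconn hv) (not_congr (hav hv))
  have hoff : ∀ (f : G.edgeFinset) (z : V), ConnOff G M f v z ↔ ConnOff G M' f v z := fun f z =>
    ⟨conn_of_agree (hclMe f) (agree_update hagree f) hv,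
      conn_of_agree (hclM'e f) (agree_update hagree' f) hv⟩
  have hclu : ∀ f : G.edgeFinset, clusterOff G M f v = clusterOff G M' f v := by
    intro f
    ext z
    rw [clusterOff_eq, clusterOff_eq, ← conn_iff_mem_cluster, ← conn_iff_mem_cluster]
    exact hoff f z
  have hpiv : ∀ d' : G.Dart, IsPivotal G M v y d' ↔ IsPivotal G M' v y d' := fun d' =>
    and_congr (hoff _ _) (by
      rw [hclu]
      exact ⟨fun h => ((hav hy).1 h.symm).symm, fun h => ((hav hy).2 h.symm).symm⟩)
  exact and_congr (hthr y) (not_congr (exists_congr fun d' => and_congr (hpiv d') (hthr d'.fst)))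

/-! ## One-bond blindness of `E_N(v, y; 𝒜)` across the cut `𝒞^b_N(v)` -/

/-- Through-connections from `v` into `𝒞^b_N(v)` do not see `n_b` (when `b̄ ∉ 𝒞^b_N(v)`). [folklore] -/
theorem connThrough_update_iff_of_mem {N : Current G} {d : G.Dart} {v : V} {A : Finset V} {a : V}
    (hw : d.snd ∉ clusterOff G N (dartEdge G d) v) (ha : a ∈ clusterOff G N (dartEdge G d) v) :
    ConnThrough G (Function.update N (dartEdge G d) 0) A v a ↔ ConnThrough G N A v a := by
  refine ⟨fun h => ⟨h.1.mono (update_zero_le N _), fun hav => h.2 (connAvoid_update_of_mem hw ha hav)⟩,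
    fun h => ⟨?_, fun hav => h.2 (hav.mono (update_zero_le N _))⟩⟩
  show Conn G _ v a
  rw [conn_iff_mem_cluster, ← clusterOff_eq]
  exact ha

/-- **Clusters inside the cut**: a vertex of `𝒞^b_N(v) ∩ 𝒞^{e}_N(v)` already lies in `𝒞^e_{N∖b}(v)`
when `b̄ ∉ 𝒞^b_N(v)` (a path from `v` avoiding `e` between two vertices of `𝒞^b_N(v)` does not use
`b`). [folklore] -/
theorem mem_clusterOff_update_of_mem {N : Current G} {d : G.Dart} {v : V} (e : G.edgeFinset)
    (hw : d.snd ∉ clusterOff G N (dartEdge G d) v) {z : V} (hz : z ∈ clusterOff G N e v)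
    (hz𝒞 : z ∈ clusterOff G N (dartEdge G d) v) :
    z ∈ clusterOff G (Function.update N (dartEdge G d) 0) e v := by
  classical
  rw [mem_clusterOff_iff] at hz
  obtain ⟨p, hp⟩ := SimpleGraph.Reachable.exists_isPath hz
  have hcut : ∀ a c, a ∈ (clusterOff G N (dartEdge G d) v : Set V) →
      c ∉ (clusterOff G N (dartEdge G d) v : Set V) →
        ((Percolation.openGraph N.traced).deleteEdges {(e : Sym2 V)}).Adj a c →
          s(a, c) = s(d.fst, d.snd) :=
    fun a c ha hc hadj => clusterOff_cut N d v a c ha hc (SimpleGraph.deleteEdges_adj.1 hadj).1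
  have hb := cut_notMem_edges_of_isPath hcut (fun h => hw (Finset.mem_coe.1 h)) hp
    (Finset.mem_coe.2 (mem_clusterOff_self N _ v)) (Finset.mem_coe.2 hz𝒞)
  rw [clusterOff_eq, Current.mem_cluster_iff, openGraph_traced_update_zero, openGraph_traced_update_zero,
    SimpleGraph.deleteEdges_deleteEdges, Set.union_comm, ← SimpleGraph.deleteEdges_deleteEdges]
  exact ⟨p.toDeleteEdge _ hb⟩

/-- **One-bond blindness of `E_N(v, y; 𝒜)`**: if `b̄ ∉ 𝒞^b_N(v)` and `y ∈ 𝒞^b_N(v)`, then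
`E_{N∖b}(v, y; 𝒜) ⟺ E_N(v, y; 𝒜)` — the event does not depend on `n_b` ("off `b`" may be
omitted, (2.34); and `{E off b}` is `E` at `n_b = 0`, (2.29)). [cite: Sakai2007, (2.29) and (2.34)] -/
theorem laceEvent_update_iff {N : Current G} {d : G.Dart} {v : V} {A : Finset V} {y : V}
    (hw : d.snd ∉ clusterOff G N (dartEdge G d) v) (hy : y ∈ clusterOff G N (dartEdge G d) v) :
    laceEvent G (Function.update N (dartEdge G d) 0) A v y ↔ laceEvent G N A v y := by
  classical
  set b := dartEdge G d with hb_def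
  set M : Current G := Function.update N b 0 with hM
  set 𝒞 := clusterOff G N b v with h𝒞_def
  have hv : v ∈ 𝒞 := mem_clusterOff_self N b v
  have hcl : ∀ a w, a ∈ (𝒞 : Set V) → (Percolation.openGraph M.traced).Adj a w → w ∈ (𝒞 : Set V) :=
    fun a w ha hadj => Finset.mem_coe.2 (mem_clusterOff_of_adj (Finset.mem_coe.1 ha) hadj)
  have hle : Percolation.openGraph M.traced ≤ Percolation.openGraph N.traced :=
    Percolation.openGraph_mono (Current.traced_mono (update_zero_le N b))
  refine and_congr (connThrough_update_iff_of_mem hw hy) (not_congr (exists_congr fun d' => ?_))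
  set e := dartEdge G d' with he_def
  have hsub : clusterOff G M e v ⊆ clusterOff G N e v := clusterOff_mono (update_zero_le N b) e v
  have hS𝒞 : clusterOff G M e v ⊆ 𝒞 := by
    rw [clusterOff_eq, h𝒞_def, clusterOff_eq]
    exact Current.cluster_mono (update_zero_le M e) v
  constructor
  · rintro ⟨⟨hoff, havd⟩, hthr⟩
    have ha : d'.fst ∈ clusterOff G M e v := by
      rw [clusterOff_eq, ← conn_iff_mem_cluster]; exact hoff
    -- `d'.snd ∈ 𝒞`: walk back from `y` inside the cluster
    obtain ⟨hc, hyS, q, hq⟩ := connAvoid_iff_exists_walk.1 havd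
    have hc𝒞 : d'.snd ∈ 𝒞 :=
      Finset.mem_coe.1 (walk_support_subset_of_closed hcl q.reverse (Finset.mem_coe.2 hy) _
        q.reverse.end_mem_support)
    have hq𝒞 : ∀ z ∈ q.support, z ∈ 𝒞 := fun z hz =>
      Finset.mem_coe.1 (walk_support_subset_of_closed hcl q (Finset.mem_coe.2 hc𝒞) z hz)
    refine ⟨⟨Conn.mono (update_zero_mono (update_zero_le N b) e) hoff, ?_⟩,
      (connThrough_update_iff_of_mem hw (hS𝒞 ha)).1 hthr⟩
    refine connAvoid_iff_exists_walk.2 ⟨fun h => hc (mem_clusterOff_update_of_mem e hw h hc𝒞),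
      fun h => hyS (mem_clusterOff_update_of_mem e hw h hy), q.mapLe hle, fun z hz h => ?_⟩
    rw [SimpleGraph.Walk.support_mapLe_eq_support] at hz
    exact hq z hz (mem_clusterOff_update_of_mem e hw h (hq𝒞 z hz))
  · rintro ⟨⟨hoff, havd⟩, hthr⟩
    have hyS : y ∉ clusterOff G N e v := (connAvoid_iff.1 havd).2.1
    -- `e` lies on every path from `v` to `y` inside the cluster: its endpoints are in `𝒞`
    have hy' := hy
    rw [h𝒞_def, clusterOff_eq, Current.mem_cluster_iff] at hy'
    obtain ⟨p, hp⟩ := SimpleGraph.Reachable.exists_isPath hy'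
    have hep : (e : Sym2 V) ∈ p.edges := by
      by_contra hep
      refine hyS (hsub ?_)
      rw [clusterOff_eq, Current.mem_cluster_iff, openGraph_traced_update_zero]
      exact ⟨p.toDeleteEdge _ hep⟩
    have hp𝒞 : ∀ z ∈ p.support, z ∈ 𝒞 := fun z hz =>
      Finset.mem_coe.1 (walk_support_subset_of_closed hcl p (Finset.mem_coe.2 hv) z hz)
    have ha𝒞 : d'.fst ∈ 𝒞 := hp𝒞 _ (p.fst_mem_support_of_mem_edges hep)
    have hc𝒞 : d'.snd ∈ 𝒞 := hp𝒞 _ (p.snd_mem_support_of_mem_edges hep)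
    have ha : d'.fst ∈ clusterOff G M e v :=
      mem_clusterOff_update_of_mem e hw (by rw [clusterOff_eq, ← conn_iff_mem_cluster]; exact hoff) ha𝒞
    refine ⟨⟨?_, ?_⟩, (connThrough_update_iff_of_mem hw ha𝒞).2 hthr⟩
    · show Conn G _ v d'.fst
      rw [conn_iff_mem_cluster, ← clusterOff_eq]
      exact ha
    · obtain ⟨hc, -, q, hq⟩ := connAvoid_iff_exists_walk.1 havd
      have hqp : q.bypass.IsPath := q.bypass_isPath
      have hbq := cut_notMem_edges_of_isPath (clusterOff_cut N d v) (fun h => hw (Finset.mem_coe.1 h))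
        hqp (Finset.mem_coe.2 hc𝒞) (Finset.mem_coe.2 hy)
      refine connAvoid_iff_exists_walk.2 ⟨fun h => hc (hsub h), fun h => hyS (hsub h), ?_⟩
      rw [hM, openGraph_traced_update_zero]
      refine ⟨q.bypass.toDeleteEdge _ hbq, fun z hz h => hq z (q.support_bypass_subset_support ?_) (hsub h)⟩
      simpa using hz

/-- The second and third indicators of (2.29) do not see `n_b`:
`1{E_{N∖b}(v,b̲;𝒜)} 1{b̄ ⟷_N x in 𝒞^b_N(v)ᶜ}` is unchanged when `n_b` is reset (the cluster does not
see `n_b`, and — as `b̲ ∈ 𝒞^b_N(v)` — neither do the connections by bonds off it). [cite: Sakai2007, (2.31)] -/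
theorem laceEvent_and_connAvoid_update_iff (N : Current G) (A : Finset V) (v x : V) (d : G.Dart) :
    (laceEvent G (Function.update N (dartEdge G d) 0) A v d.fst ∧
        ConnAvoid G N (clusterOff G N (dartEdge G d) v) d.snd x) ↔
      (laceEvent G (Function.update (Function.update N (dartEdge G d) 0) (dartEdge G d) 0) A v d.fst ∧
        ConnAvoid G (Function.update N (dartEdge G d) 0)
          (clusterOff G (Function.update N (dartEdge G d) 0) (dartEdge G d) v) d.snd x) := by
  rw [Function.update_idem, clusterOff_update]
  refine and_congr_right fun hE => ?_
  have hfst : d.fst ∈ clusterOff G N (dartEdge G d) v := by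
    rw [clusterOff_eq, ← conn_iff_mem_cluster]; exact hE.1.1
  have hb : ((dartEdge G d : G.edgeFinset) : Sym2 V) ∉
      (offGraph G (clusterOff G N (dartEdge G d) v)).edgeSet := by
    rw [mem_edgeSet_offGraph, show ((dartEdge G d : G.edgeFinset) : Sym2 V) = s(d.fst, d.snd) from rfl,
      Current.edgeOff_mk]
    exact fun h => h.2.1 hfst
  simp only [connAvoid_iff, Current.mem_connIn_iff, tracedIn_update_of_notMem N hb]

/-! ## Parities at the cut -/

/-- **Handshake on a closed vertex set**: if every bond carrying current of `n` has both or neither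
endpoint in `C`, then `C` contains an even number of sources of `n`. [folklore] -/
theorem even_card_filter_sources_of_closed (n : Current G) (C : Finset V)
    (hC : ∀ (e : G.edgeFinset) (a c : V), (e : Sym2 V) = s(a, c) → 0 < n e → (a ∈ C ↔ c ∈ C)) :
    Even #(C.filter fun v => v ∈ n.sources) := by
  have hfilter : C.filter (fun v => v ∈ n.sources) = C.filter (fun v => Odd (n.degree v)) := by
    ext v; simp only [Finset.mem_filter, Current.mem_sources_iff]
  rw [hfilter, ← Finset.even_sum_iff_even_card_odd]
  have hsum : ∑ v ∈ C, n.degree v =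
      ∑ e : G.edgeFinset, n e * #(C.filter fun v => v ∈ (e : Sym2 V)) := by
    unfold Current.degree
    rw [Finset.sum_comm]
    refine Finset.sum_congr rfl fun e _ => ?_
    rw [← Finset.sum_filter, Finset.sum_const, smul_eq_mul, mul_comm]
  rw [hsum]
  refine Finset.even_sum _ fun e _ => ?_
  rcases Nat.eq_zero_or_pos (n e) with h0 | hpos
  · rw [h0, zero_mul]; exact Even.zero
  · refine Nat.even_mul.2 (Or.inr ?_)
    obtain ⟨e, he⟩ := e
    induction e using Sym2.ind with
    | _ a b =>
      have hab : a ≠ b := G.ne_of_adj (SimpleGraph.mem_edgeFinset.1 he)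
      have hiff : a ∈ C ↔ b ∈ C := hC ⟨s(a, b), he⟩ a b rfl hpos
      have hfil : C.filter (fun v => v ∈ (s(a, b) : Sym2 V)) = ({a, b} : Finset V).filter (· ∈ C) := by
        ext v
        simp only [Finset.mem_filter, Sym2.mem_iff, Finset.mem_insert, Finset.mem_singleton]
        tauto
      change Even #(C.filter fun v => v ∈ (s(a, b) : Sym2 V))
      rw [hfil, Finset.filter_insert, Finset.filter_singleton]
      by_cases ha : a ∈ C
      · have hb : b ∈ C := hiff.1 ha
        rw [if_pos ha, if_pos hb, Finset.card_insert_of_notMem (by simpa using hab)]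
        simp
      · have hb : b ∉ C := fun hb => ha (hiff.2 hb)
        rw [if_neg ha, if_neg hb]
        simp

/-- A sub-current of `N` with `n_b` reset is closed with respect to `𝒞^b_N(v)`: its bonds are bonds
of `N ∖ b`, which do not leave the cluster. [folklore] -/
theorem closed_update_of_le {m N : Current G} (hle : m ≤ N) (b : G.edgeFinset) (v : V) :
    ∀ (e : G.edgeFinset) (a c : V), (e : Sym2 V) = s(a, c) → 0 < Function.update m b 0 e →
      (a ∈ clusterOff G N b v ↔ c ∈ clusterOff G N b v) := by
  intro e a c he hpos
  have hne : e ≠ b := by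
    rintro rfl
    rw [Function.update_self] at hpos
    exact lt_irrefl 0 hpos
  rw [Function.update_of_ne hne] at hpos
  have hadj : (Percolation.openGraph (Current.traced (Function.update N b 0))).Adj a c := by
    rw [openGraph_traced_update_adj_iff]
    have heG : s(a, c) ∈ G.edgeFinset := he ▸ e.2
    have hee : (⟨s(a, c), heG⟩ : G.edgeFinset) = e := Subtype.ext he.symm
    refine ⟨heG, fun h => hne (hee ▸ h), ?_⟩
    rw [hee]
    exact lt_of_lt_of_le hpos (hle e)
  exact ⟨fun ha => mem_clusterOff_of_adj ha hadj, fun hc => mem_clusterOff_of_adj hc hadj.symm⟩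

/-- No sub-current of `N` with `n_b` reset has exactly one source inside `𝒞^b_N(v)` and one
outside. [folklore] -/
theorem false_of_sources_update_eq {m N : Current G} (hle : m ≤ N) {b : G.edgeFinset} {v p q : V}
    (hs : Current.sources (Function.update m b 0) = ({p} : Finset V) ∆ {q})
    (hp : p ∈ clusterOff G N b v) (hq : q ∉ clusterOff G N b v) : False := by
  have heven := even_card_filter_sources_of_closed (Function.update m b 0) (clusterOff G N b v)
    (closed_update_of_le hle b v)
  have hpq : p ≠ q := fun h => hq (h ▸ hp)
  have hfilter : (clusterOff G N b v).filter (fun w => w ∈ Current.sources (Function.update m b 0)) = {p} := by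
    ext w
    simp only [Finset.mem_filter, hs, Finset.mem_symmDiff, Finset.mem_singleton]
    constructor
    · rintro ⟨hwC, hw⟩
      rcases hw with ⟨rfl, -⟩ | ⟨rfl, -⟩
      · rfl
      · exact absurd hwC hq
    · rintro rfl
      exact ⟨hp, Or.inl ⟨rfl, hpq⟩⟩
  rw [hfilter, Finset.card_singleton] at heven
  exact Nat.not_even_one heven

/-- **`∂m = ∅` forces `m_b` even** for a sub-current `m` of `N` when `b̲ ∈ 𝒞^b_N(v) ∌ b̄`
("`m_b` even … is the only possible combination consistent with the source constraints").
[cite: Sakai2007, (2.31) and (2.34)] -/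
theorem even_of_sources_empty {m N : Current G} (hle : m ≤ N) {b : G.edgeFinset} {v u w : V}
    (hb : (b : Sym2 V) = s(u, w)) (hs : m.sources = ∅) (hu : u ∈ clusterOff G N b v)
    (hw : w ∉ clusterOff G N b v) : Even (m b) := by
  by_contra hodd
  rw [Nat.not_even_iff_odd] at hodd
  have h := sources_eq_symmDiff_update m b hb
  rw [if_pos hodd, hs] at h
  have hs0 : Current.sources (Function.update m b 0) = ({u} : Finset V) ∆ {w} := by
    have := congrArg (· ∆ (({u} : Finset V) ∆ {w})) h
    rw [symmDiff_assoc (Current.sources (Function.update m b 0)), symmDiff_self, symmDiff_bot] at this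
    rw [← this, ← Finset.bot_eq_empty, bot_symmDiff]
  exact false_of_sources_update_eq hle hs0 hu hw

/-- **`∂n = v △ x` with `x ∉ 𝒞^b_N(v)` forces `n_b` odd** for a sub-current `n` of `N`
("in fact `n_b` is an odd integer"). [cite: Sakai2007, (2.31)] -/
theorem odd_of_sources_eq_pair {n N : Current G} (hle : n ≤ N) {b : G.edgeFinset} {v x u w : V}
    (hb : (b : Sym2 V) = s(u, w)) (hs : n.sources = ({v} : Finset V) ∆ {x})
    (hx : x ∉ clusterOff G N b v) : Odd (n b) := by
  by_contra heven
  have h := sources_eq_symmDiff_update n b hb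
  rw [if_neg heven, hs] at h
  have hs0 : Current.sources (Function.update n b 0) = ({v} : Finset V) ∆ {x} := by
    rw [h, ← Finset.bot_eq_empty, symmDiff_bot]
  exact false_of_sources_update_eq hle hs0 (mem_clusterOff_self N b v) hx

/-- **`∂n = v △ b̲` with `b̄ ∉ 𝒞^b_N(v)` forces `n_b` even** for a sub-current `n` of `N`
("`{∂n = v △ b̲} ∩ {n_b odd} ⊆ {b̄ ∈ 𝒞^b(v)}`"). [cite: Sakai2007, (2.34) (cf. (2.16))] -/
theorem even_of_sources_eq_pair {n N : Current G} (hle : n ≤ N) {b : G.edgeFinset} {v u w : V}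
    (hb : (b : Sym2 V) = s(u, w)) (hs : n.sources = ({v} : Finset V) ∆ {u})
    (hw : w ∉ clusterOff G N b v) : Even (n b) := by
  by_contra hodd
  rw [Nat.not_even_iff_odd] at hodd
  have h := sources_eq_symmDiff_update n b hb
  rw [if_pos hodd, hs] at h
  have hs0 : Current.sources (Function.update n b 0) = ({v} : Finset V) ∆ {w} := by
    have := congrArg (· ∆ (({u} : Finset V) ∆ {w})) h
    simp only [symmDiff_assoc, symmDiff_self, symmDiff_bot] at this
    rw [← this, symmDiff_symmDiff_cancel_left]
  exact false_of_sources_update_eq hle hs0 (mem_clusterOff_self N b v) hw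

end IsingLace

end Literature.Probability.LatticeModels

end
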